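import Summits.QuantumFields.QCD.Theses.QuarksAsStableAction
import Literature.MathematicalPhysics.QuantumLattice.WilsonDiracAP
import Summits.QuantumFields.QCD.Theorems.QuarksAsStableActionWilsonQuarkStabilityParityGlue
import Summits.QuantumFields.QCD.Theorems.QuarksAsStableActionWilsonQuarkStabilityStubBackgroundSchwarz
import Summits.QuantumFields.QCD.Theorems.QuarksAsStableActionWilsonQuarkStabilityStubReflectionStep
import Summits.QuantumFields.QCD.Theorems.QuarksAsStableActionWilsonQuarkStabilityStubChessboardOfReflection
import Summits.QuantumFields.QCD.Theorems.QuarksAsStableActionWilsonQuarkStabilityStubCyclicHolder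
import Summits.QuantumFields.QCD.Theorems.QuarksAsStableActionWilsonQuarkStabilityStubNormDetChainBlock
import Summits.QuantumFields.QCD.Theorems.QuarksAsStableActionWilsonQuarkStabilityStubStaticSliceBound
import Summits.QuantumFields.QCD.Theorems.QuarksAsStableActionWilsonQuarkStabilityStubStaticIterate
import Summits.QuantumFields.QCD.Theorems.QuarksAsStableActionWilsonQuarkStabilityStubOddOfDiamagnetic

/-!
# `QuarksAsStableAction.WilsonQuarkStability` — the crux of route QuarksAsStableAction (item stmt-QuantumFields-9736)

**Theorem (`WilsonQuarkStability_of`).**  There are `ε, δ > 0`, constants `K, c₂, C` and `L₀` such that for all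
`L ≥ L₀`, all bare masses `|m| ≤ ε` and all `SU(3)` lattice gauge fields `U` on `(ℤ/L)⁴`,
`|det D_AP[U,m]| ≤ exp(K + c₂·S_good(U) + C·N_bad(U)) · |det D_AP[𝟙,m]|` — the statement
`Summit.QuantumFields.QCD.Theses.QuarksAsStableAction.WilsonQuarkStability` BY NAME (line `Sketch`, idea
`free-tangent-landau-chessboard`; leads prover-line-stmt-QuantumFields-9736-0 / -c1-0 / -c2-0).

* EVEN tori: `wilsonQuarkStability_even` (p127884) — the background Schwarz inequality (item 10349) ⇒ the
  Fröhlich–Israel–Lieb–Simon iteration ⇒ the quark chessboard (item 9306) ⇒ free twisted Fourier analysis, the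
  antiperiodic lattice sum, the free-tangent bound, cell gauge, tiling stability and the chessboard transfer
  (stubs of cycle 1).
* ODD tori: the diamagnetic inequality `‖det D_W[V]‖ ≤ ‖det D_W[all-seams trivial field]‖` for every `U(3)` field
  on an odd torus and `m > −1` (`diamagnetic_odd`), from Lüscher's transfer-matrix form of the `r = 1` Wilson
  determinant (`wilson_det_transfer_form`, p120730), the Fock functor (`trace_fockLift`, p119264), the cyclic
  Hölder / chessboard inequality `‖Tr ∏_{t<L} T_t u_t‖^L ≤ ∏_t Re Tr T_t^L` whose extremal words are STATIC
  (period one, hence parity-blind; `stub_cyclicHolder` = `stub_reflectionStep` + `stub_chessboardOfReflection`,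
  the FILS maximiser argument for the mixed site/link reflection of the odd cycle), the temporal-link blindness of
  the chain-block determinants (`stub_normDetChainBlock`), the static slice bound (`stub_staticSliceBound`) and its
  four-axis iteration through the hypercubic covariance `det_wilsonDirac_swap` (`stub_staticIterate`); the odd half
  then holds with `ε = 1/2`, `δ = 1`, `K = c₂ = C = 0` (`stub_oddOfDiamagnetic`).
* Parity glue: `wilsonQuarkStability_of_even_of_odd` (p114957).

References: M. Lüscher, Commun. Math. Phys. 54 (1977) 283; J. Fröhlich, R. Israel, E. H. Lieb, B. Simon,
Commun. Math. Phys. 62 (1978) 1, Thm. 4.1; I. Montvay, G. Münster, *Quantum Fields on a Lattice* §4.2.3–4.2.4.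
Pure theorem file (no definitions).
-/

namespace Summit.QuantumFields.QCD.Cruxes.WilsonQuarkStability.FreeTangentLandauChessboard

open Literature.MathematicalPhysics Literature.MathematicalPhysics.QuantumLattice
  Literature.MathematicalPhysics.QuantumFieldTheory
open Matrix Complex
open scoped ComplexConjugate BigOperators ComplexOrder

noncomputable section

/-- **The diamagnetic inequality for Wilson quarks on odd tori.**  For every `U(3)` lattice gauge field `V` on
`(ℤ/L)⁴` with `L` odd and every bare mass `m > −1` (`r = 1`),
`‖det D_W[V]‖ ≤ ‖det D_W[Ṽ]‖` where `Ṽ` is the all-seams trivial field (links `1`, except `−1` on the links leaving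
the slices `x_μ = −1` in direction `μ`), i.e. the free antiperiodic determinant: composition of the line's stubs
(static slice bound from the transfer-matrix Hölder chessboard, iterated over the four axes). -/
theorem diamagnetic_odd (L : ℕ) [NeZero L] (hL : Odd L)
    (V : GaugeConfig 4 L (Matrix.unitaryGroup (Fin 3) ℂ)) (m : ℝ) (hm : -1 < m) :
    ‖(wilsonDirac (unitaryFundamentalRep (Fin 3) ℂ) V m 1).det‖ ≤
      ‖(wilsonDirac (unitaryFundamentalRep (Fin 3) ℂ)
        (fun e : Edge 4 L => if e.1 e.2 = -1 then (-1 : Matrix.unitaryGroup (Fin 3) ℂ) else 1) m 1).det‖ :=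
  stub_staticIterate
    (fun W μ hμ => stub_staticSliceBound hL
      (fun T u hT hu => stub_cyclicHolder
        (fun n T hT U hU e he ι hι c v => stub_reflectionStep n T hT U hU e he ι hι c v)
        (fun n F hF ν hν e ι hιe hrot hrefl hhom c v =>
          stub_chessboardOfReflection n F hF ν hν e ι hιe hrot hrefl hhom c v)
        hL T u hT hu)
      (fun A Pp Pm W' hP hPQ hQP hPph hPmh hW hWp hWm =>
        stub_normDetChainBlock A Pp Pm W' hP hPQ hQP hPph hPmh hW hWp hWm)
      W μ hμ)
    V m hm

/-- **The crux on ODD tori** (verbatim `QuarksAsStableAction.WilsonQuarkStability` with `Odd L →` inserted), with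
`ε = 1/2`, `δ = 1`, `K = c₂ = C = 0`, `L₀ = 0`, from `diamagnetic_odd`. -/
theorem wilsonQuarkStability_odd :
    ∃ ε δ K c₂ C : ℝ, 0 < ε ∧ 0 < δ ∧ ∃ L₀ : ℕ, ∀ (L : ℕ) [NeZero L], L₀ ≤ L → Odd L → let apDet : Literature.MathematicalPhysics.QuantumFieldTheory.GaugeConfig 4 L (Matrix.specialUnitaryGroup (Fin 3) ℂ) → ℝ → ℂ := fun U m => Literature.MathematicalPhysics.QuantumLattice.fermionDet (Literature.MathematicalPhysics.QuantumLattice.wilsonDirac (Literature.MathematicalPhysics.QuantumLattice.unitaryFundamentalRep (Fin 3) ℂ) (fun e => if e.1 e.2 = -1 then -(⟨(U e).1, Matrix.specialUnitaryGroup_le_unitaryGroup (U e).2⟩ : Matrix.unitaryGroup (Fin 3) ℂ) else ⟨(U e).1, Matrix.specialUnitaryGroup_le_unitaryGroup (U e).2⟩) m 1); let dfc : Literature.MathematicalPhysics.QuantumFieldTheory.GaugeConfig 4 L (Matrix.specialUnitaryGroup (Fin 3) ℂ) → Literature.MathematicalPhysics.QuantumFieldTheory.Plaquette 4 L → ℝ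 := fun U p => 3 - (Literature.MathematicalPhysics.QuantumLattice.fundamentalRep (Fin 3) (Literature.MathematicalPhysics.QuantumFieldTheory.plaquetteHolonomy U p.1 p.2.1.1 p.2.1.2)).trace.re; ∀ m : ℝ, |m| ≤ ε → ∀ U : Literature.MathematicalPhysics.QuantumFieldTheory.GaugeConfig 4 L (Matrix.specialUnitaryGroup (Fin 3) ℂ), ‖apDet U m‖ ≤ Real.exp (K + c₂ * (∑ p ∈ Finset.univ.filter (fun p => dfc U p < δ), dfc U p) + C * ((Finset.univ.filter (fun p => δ ≤ dfc U p)).card : ℝ)) * ‖apDet 1 m‖ :=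
  stub_oddOfDiamagnetic fun L _ hL V m hm => diamagnetic_odd L hL V m hm

/-- **The crux `QuarksAsStableAction.WilsonQuarkStability` BY NAME** (item stmt-QuantumFields-9736): even tori
(`wilsonQuarkStability_even`, p127884) and odd tori (`wilsonQuarkStability_odd`) glued by
`wilsonQuarkStability_of_even_of_odd` (p114957). -/
theorem WilsonQuarkStability_of :
    Summit.QuantumFields.QCD.Theses.QuarksAsStableAction.WilsonQuarkStability :=
  wilsonQuarkStability_of_even_of_odd wilsonQuarkStability_even wilsonQuarkStability_odd

end

end Summit.QuantumFields.QCD.Cruxes.WilsonQuarkStability.FreeTangentLandauChessboard
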